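import Summits.ABC.IUTFork.Joshi.ATS4RamificationTateDivisor
import Literature.IUT.HodgeTheaters.InitialThetaDataArith
import Literature.NumberTheory.EllipticCurves.DivisionFieldSelfRamificationProofs
import Literature.NumberTheory.NumberFields.RelativeDifferentExponents
import HarnessLib

/-!
# [J-IV] Lemma 4.1.4 (2) for Joshi's `L' = L(C[ℓ])` in the arithmetic model: `L'/L` is unramified outside the bad places and `ℓ`, and tamely ramified outside the additive places and `ℓ` — PROVED

Proof-only companion (theorems only; no definition, no named fact, no instance), rung LADDER-ABC:A2.E, seat abc-iut-E-t6
(sequel of `Joshi/InitialThetaDataJoshiSupply.lean` p431540, whose `ofArithInput` realises Joshi's §3.3 (13) field `L'` as the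
tree's division field `TorsionField C ℓ = L(C[ℓ]) ⊆ L̄`). TAKES NO SIDE on [IUTchIII] Cor. 3.12 or on any author; typed ≠ proved.
Source: K. Joshi, arXiv:2403.10430v2 = [J-IV], Lemma 4.1.4 (2), p.38 l.36–39: «The extension `L′/L` is unramified outside
`{v ∈ V_{L_tpd} : v divides 2·ℓ} ∪ Supp(𝔮_{L_tpd})` and `L′/L` is tamely ramified outside `{v ∈ V_{L_tpd} : v divides 2·ℓ}`»
(printed proof: «immediate from Proposition 4.1.1»); E-t26 types it as the CLAIM `ATS4.TowerDatum.Lem414_2` over an opaque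
tower datum with the vocabulary `ATS4.UnramifiedOutside` / `ATS4.TamelyRamifiedOutside` (`Joshi/ATS4RamificationTateDivisor.lean`
p430057).

WHAT IS PROVED (kernel; inputs = the tree's Néron–Ogg–Shafarevich-type theorems for division fields, abc-iut's
`Literature.NumberTheory.EllipticCurves.DivisionFieldSelfRamificationProofs`: unramified at good places `v ∤ ℓ`, ramification
index dividing `ℓ` at multiplicative places `v ∤ ℓ`; Silverman AEC VII.4.1, ATAEC V.4–5), for ANY elliptic curve `C` over a
number field `L` and any nonzero `ℓ` (primality not needed), in E-t26's vocabulary: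
* `unramifiedOutside_torsionField` — `L(C[ℓ])/L` is UNRAMIFIED OUTSIDE `{v : C has bad reduction at v} ∪ {v : v | ℓ}`;
* `tamelyRamifiedOutside_torsionField` — `L(C[ℓ])/L` is TAMELY RAMIFIED OUTSIDE `{v : C has additive reduction at v} ∪ {v : v | ℓ}`
  (at a multiplicative `v ∤ ℓ` the index divides `ℓ`, so the residue characteristic `p_v ≠ ℓ` does not divide it);
* `relRamIdx_dvd_of_hasMultiplicativeReductionAt` — at multiplicative `v ∤ ℓ`, `e_{w|v} ∣ ℓ`.
These exceptional sets are CONTAINED IN the printed ones as soon as [J-IV] §4.1.1 (1) / Prop. 4.1.1 hold for `C`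
(good reduction off `V^{odd,ss} ∪ {v | 2ℓ}`; `V^{odd,ss} = Supp(𝔮)` the multiplicative places; additive places only above
`2ℓ`) — `UnramifiedOutside.mono`; the statement here needs neither §4.1.1 nor Initial Theta Data, and the «2» of «2·ℓ» is not
needed on the unramified side. Conversions: E-t26's `relRamIdx` (Mathlib `ramificationIdx'`) = Mathlib's `Ideal.ramificationIdx`
(`Ideal.ramificationIdx'_eq_ramificationIdx'`); E-t26's `residueChar` (`Literature.IUT.LogVolume.residueChar`, the prime below)
divides `n` iff `(n) ⊆ 𝔭_w` (`natCast_mem_iff_absNorm_under_dvd`). No new `Prop` fact. [claim: Joshi2024ATS4, status: disputed]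
-/

noncomputable section

open scoped Classical
open NumberField IsDedekindDomain
open Literature.IUT.HodgeTheaters (TorsionField)
open Literature.IUT.LogVolume (finBelow)

universe u

namespace Summit.ABC.IUTFork.Joshi.ATS3

variable {L : Type u} [Field L] [NumberField L] (C : WeierstrassCurve L) [C.IsElliptic] (ℓ : ℕ) [NeZero ℓ]

omit [NumberField L] in
/-- E-t26's relative ramification index `e_{w|v}` (Mathlib's `ramificationIdx'` of `v = w ∩ 𝓞_L` in `w`) is Mathlib's
`Ideal.ramificationIdx` of `w` over `𝓞_L` (Dedekind domains; `v ≠ 0`). PROVED. [folklore] -/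
theorem relRamIdx_eq_ramificationIdx (K : Type*) [Field K] [NumberField K] [Algebra L K]
    (w : HeightOneSpectrum (𝓞 K)) : ATS4.relRamIdx L K w = w.asIdeal.ramificationIdx (𝓞 L) := by
  haveI := w.isPrime
  haveI : w.asIdeal.LiesOver (finBelow L K w).asIdeal := ⟨rfl⟩
  unfold ATS4.relRamIdx
  refine Ideal.ramificationIdx'_eq_ramificationIdx' (p := (finBelow L K w).asIdeal) (q := w.asIdeal) (R := 𝓞 L) ?_
  rw [Ne, Ideal.map_eq_bot_iff_of_injective (RingOfIntegers.algebraMap.injective L K)]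
  exact (finBelow L K w).ne_bot

omit [NumberField L] in
/-- `(n) ⊆ 𝔭_w` iff `(n) ⊆ 𝔭_v` for `v = w ∩ 𝓞_L` below `w`. PROVED. [folklore] -/
theorem natCast_mem_finBelow_iff (K : Type*) [Field K] [NumberField K] [Algebra L K]
    (w : HeightOneSpectrum (𝓞 K)) (n : ℕ) : (n : 𝓞 L) ∈ (finBelow L K w).asIdeal ↔ (n : 𝓞 K) ∈ w.asIdeal := by
  show (n : 𝓞 L) ∈ w.asIdeal.comap (algebraMap (𝓞 L) (𝓞 K)) ↔ _
  rw [Ideal.mem_comap, map_natCast]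

/-- **[J-IV] Lem. 4.1.4 (2), unramified part, for `L' = L(C[ℓ])`**: the `ℓ`-division field of `C/L` is UNRAMIFIED OUTSIDE the
places of bad reduction of `C` and the places above `ℓ` — for every finite place `w` of `L(C[ℓ])` whose restriction `v` to `L`
is a place of good reduction with `v ∤ ℓ`, `e_{w|v} = 1` (Néron–Ogg–Shafarevich, easy half; tree
`ramificationIdx_divisionField_self_eq_one_of_hasGoodReductionAt`). PROVED, for every elliptic `C` (no Initial Theta Data
needed). [claim: Joshi2024ATS4, status: disputed] -/
theorem unramifiedOutside_torsionField :
    ATS4.UnramifiedOutside L (TorsionField C ℓ) {v | ¬ C.HasGoodReductionAt v ∨ (ℓ : 𝓞 L) ∈ v.asIdeal} := by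
  intro w hw
  simp only [Set.mem_setOf_eq, not_or, not_not] at hw
  obtain ⟨hgood, hℓ⟩ := hw
  haveI := w.isPrime
  haveI : w.asIdeal.LiesOver (finBelow L (TorsionField C ℓ) w).asIdeal := ⟨rfl⟩
  rw [relRamIdx_eq_ramificationIdx]
  exact C.ramificationIdx_divisionField_self_eq_one_of_hasGoodReductionAt (n := ℓ) hgood hℓ w.asIdeal

/-- **At a multiplicative place `v ∤ ℓ`, `e_{w|v} ∣ ℓ`** for every place `w` of `L(C[ℓ])` above `v` (Tate curve; tree
`ramificationIdx_divisionField_self_dvd_level_of_hasMultiplicativeReductionAt`). PROVED. [claim: Joshi2024ATS4, status: disputed] -/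
theorem relRamIdx_dvd_of_hasMultiplicativeReductionAt (w : HeightOneSpectrum (𝓞 (TorsionField C ℓ)))
    (hv : C.HasMultiplicativeReductionAt (finBelow L (TorsionField C ℓ) w))
    (hℓ : (ℓ : 𝓞 L) ∉ (finBelow L (TorsionField C ℓ) w).asIdeal) :
    ATS4.relRamIdx L (TorsionField C ℓ) w ∣ ℓ := by
  haveI := w.isPrime
  haveI : w.asIdeal.LiesOver (finBelow L (TorsionField C ℓ) w).asIdeal := ⟨rfl⟩
  rw [relRamIdx_eq_ramificationIdx]
  exact C.ramificationIdx_divisionField_self_dvd_level_of_hasMultiplicativeReductionAt (n := ℓ) hv hℓ w.asIdeal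

/-- **[J-IV] Lem. 4.1.4 (2), tame part, for `L' = L(C[ℓ])`** (any `ℓ ≠ 0`; primality is not needed): the `ℓ`-division field of `C/L` is TAMELY RAMIFIED
OUTSIDE the places of additive reduction of `C` and the places above `ℓ` — at a good `v ∤ ℓ` it is unramified, at a
multiplicative `v ∤ ℓ` the index divides `ℓ` and the residue characteristic `p_v ≠ ℓ` does not divide it. PROVED, for every
elliptic `C`. [claim: Joshi2024ATS4, status: disputed] -/
theorem tamelyRamifiedOutside_torsionField :
    ATS4.TamelyRamifiedOutside L (TorsionField C ℓ) {v | C.HasAdditiveReductionAt v ∨ (ℓ : 𝓞 L) ∈ v.asIdeal} := by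
  intro w hw
  simp only [Set.mem_setOf_eq, not_or] at hw
  obtain ⟨hadd, hℓ⟩ := hw
  set K := TorsionField C ℓ
  -- the residue characteristic of `w` divides `n` iff `(n) ⊆ 𝔭_w`
  have hchar : ∀ n : ℕ, Literature.IUT.LogVolume.residueChar K w ∣ n ↔ (n : 𝓞 K) ∈ w.asIdeal := fun n =>
    (Literature.NumberTheory.NumberFields.natCast_mem_iff_absNorm_under_dvd K w.asIdeal n).symm
  rcases C.hasGoodReductionAt_or_hasMultiplicativeReductionAt_or_hasAdditiveReductionAt
      (finBelow L K w) with hg | hm | ha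
  · -- good: unramified
    have h1 : ATS4.relRamIdx L K w = 1 :=
      unramifiedOutside_torsionField C ℓ w (by simp only [Set.mem_setOf_eq, not_or, not_not]; exact ⟨hg, hℓ⟩)
    rw [h1]
    exact (Literature.IUT.LogVolume.residueChar_prime K w).not_dvd_one
  · -- multiplicative: `e ∣ ℓ`, and `p_w ∣ e ∣ ℓ` would put `ℓ` in `𝔭_w`, hence in `𝔭_v`
    intro hdvd
    have he : ATS4.relRamIdx L K w ∣ ℓ := relRamIdx_dvd_of_hasMultiplicativeReductionAt C ℓ w hm hℓ
    have hmem : (ℓ : 𝓞 K) ∈ w.asIdeal := (hchar ℓ).mp (hdvd.trans he)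
    exact hℓ ((natCast_mem_finBelow_iff (L := L) K w ℓ).mpr hmem)
  · exact absurd ha hadd

/-- The exceptional sets above in E-t26's residue-characteristic phrasing: `(ℓ) ⊆ 𝔭_v ↔ p_v ∣ ℓ`, so
`L(C[ℓ])/L` is unramified outside `{bad places} ∪ {v : p_v ∣ ℓ}` and tamely ramified outside `{additive places} ∪ {v : p_v ∣ ℓ}`
— contained in Lem. 4.1.4 (2)'s printed sets `{v | 2ℓ} ∪ Supp(𝔮)` resp. `{v | 2ℓ}` whenever §4.1.1 (1) / Prop. 4.1.1 hold for `C`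
(`ATS4.UnramifiedOutside.mono`). PROVED. [claim: Joshi2024ATS4, status: disputed] -/
theorem unramifiedOutside_torsionField_residueChar :
    ATS4.UnramifiedOutside L (TorsionField C ℓ)
      {v | ¬ C.HasGoodReductionAt v ∨ Literature.IUT.LogVolume.residueChar L v ∣ ℓ} := by
  refine ATS4.UnramifiedOutside.mono (fun v hv => ?_) (unramifiedOutside_torsionField C ℓ)
  rcases hv with hv | hv
  · exact Or.inl hv
  · exact Or.inr ((Literature.NumberTheory.NumberFields.natCast_mem_iff_absNorm_under_dvd L v.asIdeal ℓ).mp hv)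

end Summit.ABC.IUTFork.Joshi.ATS3

end
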